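import Literature.Probability.RandomPlanarGeometry.LoewnerInverseContinuity
import Literature.Probability.Process.PathSpaceTightness
import HarnessLib

/-!
# The modulus of continuity of a Loewner curve from its tip structure and its driving term (Kemppainen–Smirnov, Lemma A.5, first step)

Topic `Literature/Probability/RandomPlanarGeometry` (family `crit-ising`); theorems only (no
definition, no named fact).

A. Kemppainen, S. Smirnov, *Random curves, scaling limits and Loewner evolutions*, Ann. Probab.
45 (2017), App. A, Lemma A.5 (arXiv:1212.6215, Lemma 5.7, p. 32): for simple curves `γ_n`
parametrised by capacity with driving terms `W_n`, IF "`(W_n)` is equicontinuous" and "there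
exist increasing continuous `ψ : [0, δ) → ℝ₊` such that `ψ(0) = 0` and
`|F_n(t, y) - γ_n(t)| ≤ ψ(y)` for all `0 < y < δ` and for all `n`" — where
`F(t, y) = g_t⁻¹(W(t) + iy)` is the hyperbolic geodesic to the tip (§3.1, eq. (17)) — THEN the
conclusion of the main lemma holds; and the proof begins: "It is clearly enough to show that
`(F_n)` is an equicontinuous family of functions on `[0, T] × [0, 1]` … Let `ε > 0` and choose
`δ > 0` such that `|F_n(t, y) - γ_n(t)| ≤ ε/6`, `|γ_n(t') - γ_n(t)| ≤ ε/6` … by (17) and Lemma A.1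
[equicontinuity of Loewner chains], the family `(F_n|_{[0,T] × [δ,1]})` is equicontinuous."
This file PROVES the quantitative core of that step, in the direction used by the event form of
the main theorem (`LoewnerTransformContinuity.lean`, whose boxes prescribe a modulus of the
capacity parametrisation `γ̂ = F(·, 0)`): **a common tip-structure modulus `ψ` and a common
modulus of the driving terms give a common modulus of continuity of the curves `γ̂` in capacity
time** — KS's random variables `C_{2,α',T}` (driver Hölder norm) and `C_{3,ψ,T,R}` (tip
structure) of Prop. 3.2 control the third modulus of the boxes.

* `Loewner.dist_le_of_tipModulus` — the four-point estimate
  `|γ̂ t - γ̂ (t+r)| ≤ 2ψ(y) + 8 (y + 2T/y)/y · (|W t - W (t+r)| + 2r/y)` for `|W t - W (t+r)| ≤ y/2`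
  and `2r/y ≤ y/2` (through `F(t, y)` and `F(t+r, y)`: the tree's uniform local Lipschitz bound
  `Loewner.norm_loewnerInv_sub_le` and two-time bound `Loewner.norm_loewnerInv_add_sub_le` for
  the inverse maps `f_t = g_t⁻¹`, `LoewnerInverseContinuity.lean` = KS Lemma A.1 in local form);
* `Loewner.exists_scale_of_tipModulus` — for `ε > 0`: a height `y ≤ y₀`, a time scale `η` and a
  driver threshold `λ`, depending only on `(T, ψ, y₀, ε)`, such that `|γ̂ t - γ̂ t'| ≤ ε` whenever
  `|t - t'| ≤ η` and `|W t - W t'| ≤ λ`, for EVERY continuous `W` and every `γ̂` with tip modulus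
  `ψ` at height `y` on `[0, T]`;
* `Loewner.exists_modulusSet_of_tipModulus` — the box form: from moduli `δW` of the driving
  terms (`Process.modulusSet {0} δW`) and a tip modulus `ψ` (at all heights `y ≤ y₀`, all levels),
  explicit moduli `δγ` with `γ̂ ∈ Process.modulusSet {0} δγ` for every such pair with `γ̂ 0 = 0`.

## References

* A. Kemppainen, S. Smirnov, Ann. Probab. 45 (2017), §3.1 (Prop. 3.2, eq. (17)) and App. A,
  Lemmas A.1, A.5 (arXiv:1212.6215: Prop. 3.2, Lemmas 5.2, 5.7). [KemppainenSmirnov2017]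
* G. F. Lawler, *Conformally Invariant Processes in the Plane* (2005), Lemma 4.33. [Lawler2005]
-/

noncomputable section

open Set Filter Topology Metric Complex
open scoped NNReal

namespace Literature.Probability.RandomPlanarGeometry

namespace Loewner

variable {W : ℝ≥0 → ℝ}

/-- `‖(x + iy) - (x' + iy)‖ = |x - x'|`. [folklore] -/
theorem norm_ofReal_add_mul_I_sub (x x' y : ℝ) :
    ‖((x : ℂ) + y * I) - ((x' : ℂ) + y * I)‖ = |x - x'| := by
  rw [show ((x : ℂ) + y * I) - ((x' : ℂ) + y * I) = ((x - x' : ℝ) : ℂ) by push_cast; ring,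
    Complex.norm_real, Real.norm_eq_abs]

/-- **The four-point estimate** (KS Lemma A.5, first step, quantitatively). Let `W` be
continuous, `f_s = g_s⁻¹` the inverse Loewner maps (`loewnerInv`), `y > 0`, and suppose the tip
structure bound `‖f_s(W s + iy) - γ̂ s‖ ≤ ψy` for `s ≤ T`. Then for `t + r ≤ T` with
`|W t - W (t+r)| ≤ y/2` and `2r/y ≤ y/2`,
`dist (γ̂ t) (γ̂ (t+r)) ≤ 2ψy + 8 (y + 2T/y)/y · (|W t - W (t+r)| + 2r/y)` — through the points
`f_t(W t + iy)`, `f_t(W (t+r) + iy)`, `f_{t+r}(W (t+r) + iy)` (local Lipschitz bound in `z`,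
two-time bound in `t`). [cite: KemppainenSmirnov2017, App. A Lemma A.5 (proof) and Lemma A.1] -/
theorem dist_le_of_tipModulus (hW : Continuous W) {γ : ℝ≥0 → ℂ} {T t r : ℝ≥0} (htr : t + r ≤ T)
    {y ψy : ℝ} (hy : 0 < y)
    (htip : ∀ s : ℝ≥0, s ≤ T → ‖loewnerInv W s ((W s : ℂ) + y * I) - γ s‖ ≤ ψy)
    (hWd : |W t - W (t + r)| ≤ y / 2) (hr : 2 * (r : ℝ) / y ≤ y / 2) :
    dist (γ t) (γ (t + r)) ≤
      2 * ψy + 8 * ((y + 2 * T / y) / y) * (|W t - W (t + r)| + 2 * r / y) := by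
  set z : ℂ := (W (t + r) : ℂ) + y * I with hz
  set w : ℂ := (W t : ℂ) + y * I with hw
  have hzim : z.im = y := by simp [hz]
  have hzpos : 0 < z.im := by rwa [hzim]
  have hwz : ‖w - z‖ = |W t - W (t + r)| := norm_ofReal_add_mul_I_sub _ _ _
  have ht : t ≤ T := le_trans (le_add_of_nonneg_right (zero_le)) htr
  -- the two inverse-map estimates, at the base point `z` (imaginary part `y`)
  have h1 : ‖loewnerInv W t w - loewnerInv W t z‖ ≤
      8 * ((y + 2 * t / y) / y) * |W t - W (t + r)| := by
    have h := norm_loewnerInv_sub_le hW t hzpos (by rw [hwz, hzim]; exact hWd)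
    rwa [hwz, hzim] at h
  have h2 : ‖loewnerInv W (t + r) z - loewnerInv W t z‖ ≤
      8 * ((y + 2 * t / y) / y) * (2 * r / y) := by
    have h := norm_loewnerInv_add_sub_le hW t r hzpos (by rw [hzim]; exact hr)
    rwa [hzim] at h
  -- the constant at time `t` is at most the constant at time `T`
  have hC : 8 * ((y + 2 * t / y) / y) ≤ 8 * ((y + 2 * T / y) / y) := by
    have : (t : ℝ) ≤ T := by exact_mod_cast ht
    gcongr
  have hA : dist (γ t) (loewnerInv W t w) ≤ ψy := by
    rw [dist_comm, dist_eq_norm]; exact htip t ht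
  have hD : dist (loewnerInv W (t + r) z) (γ (t + r)) ≤ ψy := by
    rw [dist_eq_norm]; exact htip (t + r) htr
  have hB : dist (loewnerInv W t w) (loewnerInv W t z) ≤
      8 * ((y + 2 * T / y) / y) * |W t - W (t + r)| := by
    rw [dist_eq_norm]
    exact h1.trans (mul_le_mul_of_nonneg_right hC (abs_nonneg _))
  have hCD : dist (loewnerInv W t z) (loewnerInv W (t + r) z) ≤
      8 * ((y + 2 * T / y) / y) * (2 * r / y) := by
    rw [dist_comm, dist_eq_norm]
    exact h2.trans (mul_le_mul_of_nonneg_right hC (by positivity))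
  calc dist (γ t) (γ (t + r))
      ≤ dist (γ t) (loewnerInv W t w) + dist (loewnerInv W t w) (loewnerInv W t z) +
          dist (loewnerInv W t z) (γ (t + r)) := dist_triangle4 _ _ _ _
    _ ≤ dist (γ t) (loewnerInv W t w) + dist (loewnerInv W t w) (loewnerInv W t z) +
          (dist (loewnerInv W t z) (loewnerInv W (t + r) z) +
            dist (loewnerInv W (t + r) z) (γ (t + r))) :=
        add_le_add le_rfl (dist_triangle _ _ _)
    _ ≤ ψy + 8 * ((y + 2 * T / y) / y) * |W t - W (t + r)| +
          (8 * ((y + 2 * T / y) / y) * (2 * r / y) + ψy) :=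
        add_le_add (add_le_add hA hB) (add_le_add hCD hD)
    _ = 2 * ψy + 8 * ((y + 2 * T / y) / y) * (|W t - W (t + r)| + 2 * r / y) := by ring

/-- **One scale of the common modulus.** Given the horizon `T`, a tip modulus `ψ → 0` at `0⁺`,
a maximal height `y₀ > 0` and `ε > 0`, there are a height `0 < y ≤ y₀`, a time scale `η > 0`
and a driver threshold `λ > 0` such that for EVERY continuous driving function `W` and every
`γ̂` with `‖f_s(W s + iy) - γ̂ s‖ ≤ ψ y` on `[0, T]`: `dist (γ̂ t) (γ̂ t') ≤ ε` as soon as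
`dist t t' ≤ η` and `|W t - W t'| ≤ λ` (`t, t' ≤ T`). (KS: "choose `δ > 0` such that
`|F_n(t, y) - γ_n(t)| ≤ ε/6` … for all `n`".) [cite: KemppainenSmirnov2017, App. A Lemma A.5 (proof)] -/
theorem exists_scale_of_tipModulus (T : ℝ≥0) {ψ : ℝ → ℝ} (hψ : Tendsto ψ (𝓝[>] 0) (𝓝 0))
    {y₀ : ℝ} (hy₀ : 0 < y₀) {ε : ℝ} (hε : 0 < ε) :
    ∃ y η lam : ℝ, 0 < y ∧ y ≤ y₀ ∧ 0 < η ∧ 0 < lam ∧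
      ∀ (W : ℝ≥0 → ℝ), Continuous W → ∀ γ : ℝ≥0 → ℂ,
        (∀ s : ℝ≥0, s ≤ T → ‖loewnerInv W s ((W s : ℂ) + y * I) - γ s‖ ≤ ψ y) →
        ∀ t t' : ℝ≥0, t ≤ T → t' ≤ T → dist t t' ≤ η → |W t - W t'| ≤ lam →
          dist (γ t) (γ t') ≤ ε := by
  -- a height `y ≤ y₀` with `|ψ y| < ε/4`
  have hev : ∀ᶠ y in 𝓝[>] (0 : ℝ), dist (ψ y) 0 < ε / 4 ∧ y ∈ Ioc (0 : ℝ) y₀ :=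
    ((Metric.tendsto_nhds.1 hψ) (ε / 4) (by positivity)).and (Ioc_mem_nhdsGT hy₀)
  obtain ⟨y, hψy, hy, hyy₀⟩ := hev.exists
  rw [Real.dist_0_eq_abs] at hψy
  set C : ℝ := 8 * ((y + 2 * T / y) / y) with hCdef
  have hCpos : 0 < C := by positivity
  refine ⟨y, min (y ^ 2 / 4) (ε * y / (8 * C)), min (y / 2) (ε / (4 * C)), hy, hyy₀,
    by positivity, by positivity, ?_⟩
  intro W hW γ htip t t' ht ht' hdist hWd
  -- reduce to `t ≤ t'`, `t' = t + r`
  wlog htt' : t ≤ t' generalizing t t'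
  · rw [dist_comm]
    rw [dist_comm] at hdist
    rw [abs_sub_comm] at hWd
    exact this t' t ht' ht hdist hWd (le_of_not_ge htt')
  obtain ⟨r, rfl⟩ : ∃ r, t' = t + r := ⟨t' - t, (add_tsub_cancel_of_le htt').symm⟩
  have hrdist : dist t (t + r) = r := by
    rw [NNReal.dist_eq, NNReal.coe_add, show (t : ℝ) - (t + r) = -r by ring, abs_neg,
      abs_of_nonneg r.coe_nonneg]
  rw [hrdist] at hdist
  have hr1 : (r : ℝ) ≤ y ^ 2 / 4 := hdist.trans (min_le_left _ _)
  have hr2 : (r : ℝ) ≤ ε * y / (8 * C) := hdist.trans (min_le_right _ _)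
  have hW1 : |W t - W (t + r)| ≤ y / 2 := hWd.trans (min_le_left _ _)
  have hW2 : |W t - W (t + r)| ≤ ε / (4 * C) := hWd.trans (min_le_right _ _)
  have hr : 2 * (r : ℝ) / y ≤ y / 2 := by
    rw [div_le_iff₀ hy]
    nlinarith
  have hmain := dist_le_of_tipModulus hW ht' hy htip hW1 hr
  have h3 : 2 * (r : ℝ) / y ≤ ε / (4 * C) := by
    rw [div_le_iff₀ hy]
    have := (le_div_iff₀ (by positivity : (0 : ℝ) < 8 * C)).1 hr2
    calc 2 * (r : ℝ) = (r * (8 * C)) / (4 * C) := by field_simp; ring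
      _ ≤ (ε * y) / (4 * C) := by gcongr
      _ = ε / (4 * C) * y := by ring
  calc dist (γ t) (γ (t + r))
      ≤ 2 * ψ y + C * (|W t - W (t + r)| + 2 * r / y) := hmain
    _ ≤ 2 * (ε / 4) + C * (ε / (4 * C) + ε / (4 * C)) := by
        gcongr
        exact (le_abs_self _).trans hψy.le
    _ = ε := by field_simp; ring

/-- **The common modulus of the curves from the moduli of the driving terms and the tip
structure** (box form). Given moduli `δW k > 0` for the driving terms on the levels `[0, k+1]`
(`Process.modulusSet {0} δW`), a tip modulus `ψ → 0` at `0⁺` and a maximal height `y₀ > 0`,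
there are moduli `δγ k > 0` such that every capacity-parametrised curve `γ̂` with `γ̂ 0 = 0`
whose continuous driving term `W` has the moduli `δW` and whose tip structure is bounded by
`ψ` (`‖f_s(W s + iy) - γ̂ s‖ ≤ ψ y` for `s ≤ k+1`, `0 < y ≤ y₀`, all `k`) has the moduli `δγ`:
`γ̂ ∈ Process.modulusSet {0} δγ`. Hence the tightness of KS's `C_{2,α',T}` and `C_{3,ψ,T,R}`
(Prop. 3.2) gives the tightness of the modulus of `γ̂` required by the boxes of
`LoewnerTransformContinuity.lean`. [cite: KemppainenSmirnov2017, Prop. 3.2 and App. A Lemma A.5] -/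
theorem exists_modulusSet_of_tipModulus {δW : ℕ → ℝ} (hδW : ∀ k, 0 < δW k) {ψ : ℝ → ℝ}
    (hψ : Tendsto ψ (𝓝[>] 0) (𝓝 0)) {y₀ : ℝ} (hy₀ : 0 < y₀) :
    ∃ δγ : ℕ → ℝ, (∀ k, 0 < δγ k) ∧ ∀ (W : C(ℝ≥0, ℝ)) (γ : C(ℝ≥0, ℂ)),
      W ∈ Process.modulusSet ({0} : Set ℝ) δW →
      (∀ (k : ℕ) (s : ℝ≥0), (s : ℝ) ≤ k + 1 → ∀ y : ℝ, 0 < y → y ≤ y₀ →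
        ‖loewnerInv W s ((W s : ℂ) + y * I) - γ s‖ ≤ ψ y) →
      γ 0 = 0 → γ ∈ Process.modulusSet ({0} : Set ℂ) δγ := by
  -- one scale per level `k`: horizon `k+1`, target `1/(k+1)`
  have hk : ∀ k : ℕ, ∃ y η lam : ℝ, 0 < y ∧ y ≤ y₀ ∧ 0 < η ∧ 0 < lam ∧
      ∀ (W : ℝ≥0 → ℝ), Continuous W → ∀ γ : ℝ≥0 → ℂ,
        (∀ s : ℝ≥0, s ≤ (k : ℝ≥0) + 1 → ‖loewnerInv W s ((W s : ℂ) + y * I) - γ s‖ ≤ ψ y) →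
        ∀ t t' : ℝ≥0, t ≤ (k : ℝ≥0) + 1 → t' ≤ (k : ℝ≥0) + 1 → dist t t' ≤ η →
          |W t - W t'| ≤ lam → dist (γ t) (γ t') ≤ 1 / ((k : ℝ) + 1) := fun k ↦
    exists_scale_of_tipModulus ((k : ℝ≥0) + 1) hψ hy₀ (by positivity)
  choose y η lam hy hyy₀ hη hlam hscale using hk
  -- a level `j k ≥ k` whose driver bound `1/(j+1)` is below the threshold `lam k`
  have hj : ∀ k : ℕ, ∃ j : ℕ, k ≤ j ∧ 1 / ((j : ℝ) + 1) ≤ lam k := by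
    intro k
    obtain ⟨j₀, hj₀⟩ := exists_nat_one_div_lt (hlam k)
    refine ⟨max k j₀, le_max_left _ _, le_trans ?_ hj₀.le⟩
    gcongr
    exact_mod_cast le_max_right k j₀
  choose j hjk hjlam using hj
  refine ⟨fun k ↦ min (η k) (δW (j k)), fun k ↦ lt_min (hη k) (hδW (j k)), ?_⟩
  intro W γ hWmod htip hγ0
  refine ⟨by simpa using hγ0, fun k s t hs ht hst ↦ ?_⟩
  have hsT : s ≤ (k : ℝ≥0) + 1 := by
    have : ((s : ℝ≥0) : ℝ) ≤ ((k : ℝ≥0) + 1 : ℝ≥0) := by push_cast; exact hs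
    exact_mod_cast this
  have htT : t ≤ (k : ℝ≥0) + 1 := by
    have : ((t : ℝ≥0) : ℝ) ≤ ((k : ℝ≥0) + 1 : ℝ≥0) := by push_cast; exact ht
    exact_mod_cast this
  -- driver closeness from the driver modulus at level `j k`
  have hsj : (s : ℝ) ≤ (j k : ℝ) + 1 := hs.trans (by exact_mod_cast Nat.succ_le_succ (hjk k))
  have htj : (t : ℝ) ≤ (j k : ℝ) + 1 := ht.trans (by exact_mod_cast Nat.succ_le_succ (hjk k))
  have hWst : |W s - W t| ≤ lam k := by
    have h := hWmod.2 (j k) s t hsj htj (hst.trans (min_le_right _ _))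
    rw [Real.dist_eq] at h
    exact h.trans (hjlam k)
  exact hscale k W W.continuous γ (fun u hu ↦ htip k u (by exact_mod_cast hu) (y k) (hy k) (hyy₀ k))
    s t hsT htT (hst.trans (min_le_left _ _)) hWst

end Loewner

end Literature.Probability.RandomPlanarGeometry
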